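import Summits.BirchSwinnertonDyer.Rank1Residual.GaloisImage.FiniteSingularComparisonLocal
import Literature.NumberTheory.GaloisRepresentations.DecompositionGroupOfCompletion
import Literature.NumberTheory.Automorphic.AdicCompletionResidueCard
import Mathlib.NumberTheory.Padics.HeightOneSpectrum
import HarnessLib

/-!
# The canonical finite–singular comparison map, III: the Kolyvagin datum with THE canonical
# comparison maps at Sakamoto's primes over `ℚ`
# (cell `b2b-bsdres`, team n1011, seat p04 gen 4, OWNERS row T-HCC; file 3/3)

HONEST FRAMING (cell `b2b-bsdres`, run/shared/lean/b2b/bsd-rank1-residual/, verbatim in every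
file): the goal of the cell is to DELETE the COMBINATION-SHAPED residual classes of the
Birch–Swinnerton-Dyer formula for ALL analytic-rank `≤ 1` elliptic curves over `ℚ` — "full BSD
formula for every rank `≤ 1` curve in class `C`" assembled STRICTLY from published theorems — so
that the rank-`≤ 1` remainder becomes exactly the CONSTRUCTION-SHAPED classes, which are TYPED
(missing-input `Prop`s), NOT attempted. This is not "finishing BSD". Team n1011 (N10 / N11, the
additive block X4 ∧ `p = 3`): research route on the CONSTRUCTION-SHAPED class X4; no claim beyond the
stated classes; nothing is booked. Theorems only (no definition, no named fact, no `sorry`).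

## What is proved

The binders `(D : KolyvaginDatum ρ) (η) (hP : D.primes = frobeniusClassPrimes ρ S τ N)
(hT : D.transverse = cyclotomicTransverse ρ) (hD : D.HasCanonicalComparison N η)` of the N11 instance
of Sakamoto 2024 Thm. 4.4 (1) (n1011-p13 `GaloisImage/SakamotoN11Instance`, p255331; n1011-p18
`…Weil`, p257091) are DISCHARGED from hypotheses those theorems already carry —
`τ ∈ Gal(ℚ̄/ℚ(μ_N))` (`hτμ`) and `T/(τ − 1)T ≅ ℤ/N` (`hτq`, Sakamoto's (H.2)):

* `FSComp.exists_kolyvaginDatum_hasCanonicalComparison_frobeniusClassPrimes` (`K = ℚ`): for every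
  `S`, every `𝒯` and every family of primitive roots `η_ℓ` at the primes of
  `𝒫 = frobeniusClassPrimes ρ S τ N`,
  `∃ D, D.primes = 𝒫 ∧ D.transverse = 𝒯 ∧ D.HasCanonicalComparison N η`;
* `FSComp.exists_eta_kolyvaginDatum_hasCanonicalComparison_frobeniusClassPrimes`: `∃ η D, …` with
  the primitive roots chosen as well (`(ℤ/ℓ)ˣ` is cyclic).

Steps (§9–§10 for any number field `K`, §11 for `ℚ`): §9 **`P(1) = det(1 − τ | T) = 0`** from
`T/(τ − 1)T ≅ ℤ/N` (`eval_one_comparisonP_eq_zero_of_cokerSubOne`; Cayley–Hamilton gives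
`det B • x ∈ im B`, and `ℤ/N` is a faithful `ℤ/N`-module); §10 at `𝔮 ∈ 𝒫` every arithmetic
Frobenius of `Γ_{K_𝔮}` acts on `T` as a CONJUGATE of `τ` (`exists_toLocal_eq_conj`: local ⟹ global
Frobenius at the prime `𝔓₀ ∣ 𝔮` of `K_𝔮`, tree `isArithFrobAt_absGaloisRestrict_adicCompletionPrime_iff`;
conjugate primes, `exists_smul_eq_of_mem_primesAbove_holds` + Mathlib `IsArithFrobAt.conj`; two
Frobenii at `𝔓₀` differ by inertia, Mathlib `IsArithFrobAt.mul_inv_mem_inertia`, killed since `𝔮`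
is unramified), so `P_𝔮 = P_τ` (`comparisonP_toLocal_eq`, Mathlib `LinearEquiv.charpoly_conj`) and
`P_𝔮(1) = 0`; and **`N𝔮 ≡ 1 (mod N)`** (`natCast_absNorm_eq_one`: the Frobenius fixes `μ_N`, so
`χ_N = 1`, while `χ_N(Frob) = N𝔮`, tree `modNCyclotomicCharacter_eq_residueCard_of_isArithFrobAt`);
§11 over `ℚ`, `N𝔮 = ℓ` is prime (Mathlib `Rat.HeightOneSpectrum.prime_natGenerator`), so a
generator of `(ℤ/ℓ)ˣ` has order `ℓ − 1` and `N ∣ ℓ − 1` (`dvd_orderOf_of_mem_frobeniusClassPrimes`);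
assembly by file II's `exists_kolyvaginDatum_hasCanonicalComparison`.

Scope kept honest: for a general number field the cyclotomic transverse field `K_𝔮(μ_{N𝔮})` is
the printed one only for `K = ℚ` (tree TODO in `KolyvaginSystems.lean`), and `N ∣ N𝔮 − 1` does not
give `N ∣ #(ℤ/N𝔮)ˣ` when `N𝔮` is not prime — hence §11 is stated over `ℚ` only.

References: R. Sakamoto, JTNB 36 (2024) §2 (the set `𝒫`, (H.2)), §4; K. Rubin, PCMI 18 (2011)
Def. 1.9.6, Def. 2.1.3 ("`ℓ ≡ 1 (mod p^m)` and `A/(Fr_ℓ − 1)A` free of rank one"); C.-H. Kim,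
AJM 148 (2026) §2.2.2; J. Neukirch, *Algebraic Number Theory*, Ch. I §9, Ch. II §9 (Frobenius and
completion).
-/

noncomputable section

open Field Polynomial
open Literature.NumberTheory.GaloisRepresentations
open Literature.NumberTheory.GaloisRepresentations.DiscreteGaloisModule
open scoped ContRepresentation Polynomial

universe u

namespace Summit.BirchSwinnertonDyer.Rank1Residual.GaloisImage

namespace FSComp

/-! ### §9 `P(1) = 0` from `T/(τ − 1)T ≅ ℤ/N`, and its transport to the local Frobenii at Sakamoto's primes -/

section DetZero

variable {F : Type u} [Field F] {M : Type u} [AddCommGroup M] [TopologicalSpace M]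
  [DiscreteTopology M]
variable (ρ : DiscreteGaloisModule F M) (N : ℕ) [NeZero N] [Module (ZMod N) M]
  [Module.Free (ZMod N) M] [Module.Finite (ZMod N) M]

/-- **Cayley–Hamilton: `det B • x ∈ im B`** for an endomorphism `B` of a finite free module
(`χ_B(B) = 0` and `χ_B = X·(χ_B /X) + det B` up to sign). [folklore] -/
theorem det_smul_mem_range {A : Type*} [CommRing A] {V : Type*} [AddCommGroup V] [Module A V]
    [Module.Free A V] [Module.Finite A V] (B : Module.End A V) (x : V) :
    LinearMap.det B • x ∈ LinearMap.range B := by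
  have hCH := LinearMap.aeval_self_charpoly B
  rw [← X_mul_divX_add B.charpoly, map_add, map_mul, aeval_X, aeval_C] at hCH
  have h := LinearMap.congr_fun hCH x
  simp only [LinearMap.add_apply, Module.End.mul_apply, LinearMap.zero_apply,
    Module.algebraMap_end_apply] at h
  have h' : B.charpoly.coeff 0 • x = B (-(aeval B B.charpoly.divX x)) := by
    rw [map_neg, eq_neg_iff_add_eq_zero, add_comm, h]
  rw [LinearMap.det_eq_sign_charpoly_coeff, mul_smul, h']
  exact Submodule.smul_mem _ _ (LinearMap.mem_range_self B _)

omit [NeZero N] in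
/-- `P(1) = det(1 − τ | M)` for Rubin's `P(x) = det(1 − τx | M)` (sum of the coefficients of the
reverse characteristic polynomial). [folklore] -/
theorem eval_one_comparisonP (τ : absoluteGaloisGroup F) :
    (ρ.comparisonP N τ).eval 1 = LinearMap.det (1 - ρ.zmodEnd N τ) := by
  rw [comparisonP_def]
  have h := aeval_reverse_mul_pow (E := ZMod N) (one_mul (1 : ZMod N)) (ρ.zmodEnd N τ).charpoly
  rw [one_pow, mul_one, coe_aeval_eq_eval, LinearMap.eval_charpoly, map_one] at h
  exact h

/-- **`P(1) = det(1 − τ | T) = 0` when `T/(τ − 1)T` is free of rank one over `ℤ/N`** (the (H.2)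
hypothesis of Sakamoto 2024 §2, `Nonempty (cokerSubOne ρ τ ≃+ ZMod N)`): `det(1 − τ)` kills
`coker(1 − τ) ≅ ℤ/N`, a faithful `ℤ/N`-module. [folklore] -/
theorem eval_one_comparisonP_eq_zero_of_cokerSubOne (τ : absoluteGaloisGroup F)
    (h : Nonempty (Literature.NumberTheory.GaloisCohomology.cokerSubOne ρ τ ≃+ ZMod N)) :
    (ρ.comparisonP N τ).eval 1 = 0 := by
  obtain ⟨e⟩ := h
  rw [eval_one_comparisonP]
  set d : ZMod N := LinearMap.det (1 - ρ.zmodEnd N τ) with hd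
  -- a generator `x₀` of the cokernel
  obtain ⟨x₀, hx₀⟩ := QuotientAddGroup.mk_surjective (e.symm 1)
  -- `d • x₀ ∈ im (1 − τ) = im (τ − 1)`
  have hmem : d • x₀ ∈ ((ρ τ : M →ₗ[ℤ] M).toAddMonoidHom - AddMonoidHom.id M).range := by
    obtain ⟨y, hy⟩ := det_smul_mem_range (1 - ρ.zmodEnd N τ) x₀
    refine ⟨-y, ?_⟩
    rw [← hd] at hy
    rw [← hy]
    simp only [AddMonoidHom.sub_apply, LinearMap.toAddMonoidHom_coe, AddMonoidHom.id_apply,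
      LinearMap.sub_apply, Module.End.one_apply, zmodEnd_apply, map_neg]
    abel
  have hzero : (QuotientAddGroup.mk (d • x₀) :
      Literature.NumberTheory.GaloisCohomology.cokerSubOne ρ τ) = 0 :=
    (QuotientAddGroup.eq_zero_iff _).mpr hmem
  have hval : d • x₀ = d.val • x₀ := by
    rw [← Nat.cast_smul_eq_nsmul (ZMod N) d.val x₀, ZMod.natCast_zmod_val]
  rw [hval, QuotientAddGroup.mk_nsmul, hx₀, ← map_nsmul] at hzero
  have h1 : d.val • (1 : ZMod N) = d := by
    rw [nsmul_eq_mul, mul_one, ZMod.natCast_zmod_val]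
  rw [h1, e.symm.map_eq_zero_iff] at hzero
  exact hzero

end DetZero


/-! ### §10 Sakamoto's primes: local Frobenii act as conjugates of `τ`; `N𝔮 ≡ 1 (mod N)` -/

section SakamotoPrimes

open NumberField IsDedekindDomain
open Literature.NumberTheory.GaloisCohomology
open scoped NumberField

variable {K : Type u} [Field K] [NumberField K]
variable {M : Type u} [AddCommGroup M] [TopologicalSpace M] [DiscreteTopology M]
variable (ρ : DiscreteGaloisModule K M) (N : ℕ) [NeZero N] [Module (ZMod N) M]
  [Module.Free (ZMod N) M] [Module.Finite (ZMod N) M]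

omit [NeZero N] [Module (ZMod N) M] [Module.Free (ZMod N) M] [Module.Finite (ZMod N) M] in
/-- **At a prime `𝔮` of Sakamoto's set `𝒫 = frobeniusClassPrimes ρ S τ N`, every arithmetic
Frobenius of `Γ_{K_𝔮}` acts on `T` as a conjugate of `τ`**: its image in `Γ_K` is a Frobenius at
the prime `𝔓₀ ∣ 𝔮` cut out by `K_𝔮` (`isArithFrobAt_absGaloisRestrict_adicCompletionPrime_iff`),
the Frobenius `σ` of the definition of `𝒫` (with `ρ σ = ρ τ`) sits at a conjugate prime
`𝔓 = g⁻¹ • 𝔓₀` (transitivity, `exists_smul_eq_of_mem_primesAbove_holds`; Mathlib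
`IsArithFrobAt.conj`), and two Frobenii at `𝔓₀` differ by inertia (Mathlib
`IsArithFrobAt.mul_inv_mem_inertia`), which `ρ` kills (`𝔮 ∈ 𝒫` is unramified).
Sakamoto, JTNB 36 (2024) §2 ("`Fr_𝔮` is conjugate to `τ` in `Gal(H_α(T)/K)`"). [folklore] -/
theorem exists_toLocal_eq_conj (S : Set (HeightOneSpectrum (𝓞 K))) (τ : absoluteGaloisGroup K)
    {q : HeightOneSpectrum (𝓞 K)} (hq : q ∈ frobeniusClassPrimes ρ S τ N)
    {φ : absoluteGaloisGroup (q.adicCompletion K)} (hφ : IsAbsArithFrob φ) :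
    ∃ g : absoluteGaloisGroup K, GaloisRep.toLocal q ρ φ = ρ g * ρ τ * ρ g⁻¹ := by
  obtain ⟨-, -, hunr, σ, ⟨𝔓, h𝔓, hσ⟩, hστ, -⟩ := hq
  have h𝔓₀ := adicCompletionPrime_mem_primesAbove K q
  have hcard : IsNonarchimedeanLocalField.residueFieldCard (q.adicCompletion K) =
      Nat.card (𝓞 K ⧸ q.asIdeal) := by
    rw [Literature.NumberTheory.Automorphic.residueFieldCard_adicCompletion_eq,
      HeightOneSpectrum.residueCard_eq_card_quotient]
  have hres : IsArithFrobAt (𝓞 K) (absGaloisRestrict K (q.adicCompletion K) φ)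
      (adicCompletionPrime K q) :=
    (isArithFrobAt_absGaloisRestrict_adicCompletionPrime_iff K q hcard φ).mpr hφ
  obtain ⟨g, hg⟩ := HeightOneSpectrum.exists_smul_eq_of_mem_primesAbove_holds h𝔓 h𝔓₀
  have hσ' : IsArithFrobAt (𝓞 K) (g * σ * g⁻¹) (adicCompletionPrime K q) := by
    rw [← hg]; exact hσ.conj g
  have h1 : ρ (absGaloisRestrict K (q.adicCompletion K) φ * (g * σ * g⁻¹)⁻¹) = 1 :=
    hunr _ h𝔓₀ _ (hres.mul_inv_mem_inertia hσ')
  have hρσ : ρ σ = ρ τ := by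
    have h2 : ρ (σ * τ⁻¹) = 1 := LinearMap.ext fun m => hστ m
    calc ρ σ = ρ (σ * τ⁻¹ * τ) := by rw [inv_mul_cancel_right]
      _ = ρ τ := by rw [map_mul, h2, one_mul]
  refine ⟨g, ?_⟩
  rw [GaloisRep.toLocal_apply]
  calc ρ (absGaloisRestrict K (q.adicCompletion K) φ)
      = ρ (absGaloisRestrict K (q.adicCompletion K) φ * (g * σ * g⁻¹)⁻¹ * (g * σ * g⁻¹)) := by
        rw [inv_mul_cancel_right]
    _ = ρ g * ρ τ * ρ g⁻¹ := by rw [map_mul, h1, one_mul, map_mul, map_mul, hρσ]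

omit [NeZero N] in
/-- **`P_𝔮 = P_τ`**: at `𝔮 ∈ frobeniusClassPrimes ρ S τ N`, Rubin's `P(x) = det(1 − φx | T)` for a
local arithmetic Frobenius `φ` equals `det(1 − τx | T)` (characteristic polynomials are conjugation
invariant, Mathlib `LinearEquiv.charpoly_conj`). [folklore] -/
theorem comparisonP_toLocal_eq (S : Set (HeightOneSpectrum (𝓞 K))) (τ : absoluteGaloisGroup K)
    {q : HeightOneSpectrum (𝓞 K)} (hq : q ∈ frobeniusClassPrimes ρ S τ N)
    {φ : absoluteGaloisGroup (q.adicCompletion K)} (hφ : IsAbsArithFrob φ) :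
    comparisonP (GaloisRep.toLocal q ρ) N φ = ρ.comparisonP N τ := by
  obtain ⟨g, hg⟩ := exists_toLocal_eq_conj ρ N S τ hq hφ
  let e : M ≃ₗ[ZMod N] M := LinearEquiv.ofLinear (ρ.zmodEnd N g) (ρ.zmodEnd N g⁻¹)
    (zmodEnd_mul_inv_self ρ N g) (zmodEnd_inv_mul_self ρ N g)
  have hconj : zmodEnd (GaloisRep.toLocal q ρ) N φ = e.conj (ρ.zmodEnd N τ) := by
    ext m
    rw [zmodEnd_apply, hg, LinearEquiv.conj_apply_apply, LinearEquiv.ofLinear_apply,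
      LinearEquiv.ofLinear_symm_apply, zmodEnd_apply, zmodEnd_apply, zmodEnd_apply,
      Module.End.mul_apply, Module.End.mul_apply]
  rw [comparisonP_def, comparisonP_def, hconj, LinearEquiv.charpoly_conj]

/-- **`P(1) = 0` at every arithmetic Frobenius of every `𝔮 ∈ frobeniusClassPrimes ρ S τ N`**, from
Sakamoto's (H.2) `T/(τ − 1)T ≅ ℤ/N` — the `P(1) = 0` clause of `HasCanonicalComparison`
discharged for Sakamoto's primes. [folklore] -/
theorem eval_one_comparisonP_toLocal_eq_zero (S : Set (HeightOneSpectrum (𝓞 K)))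
    (τ : absoluteGaloisGroup K) (hcoker : Nonempty (cokerSubOne ρ τ ≃+ ZMod N))
    {q : HeightOneSpectrum (𝓞 K)} (hq : q ∈ frobeniusClassPrimes ρ S τ N)
    (φ : absoluteGaloisGroup (q.adicCompletion K)) (hφ : IsAbsArithFrob φ) :
    (comparisonP (GaloisRep.toLocal q ρ) N φ).eval 1 = 0 := by
  rw [comparisonP_toLocal_eq ρ N S τ hq hφ]
  exact eval_one_comparisonP_eq_zero_of_cokerSubOne ρ N τ hcoker

omit [Module (ZMod N) M] [Module.Free (ZMod N) M] [Module.Finite (ZMod N) M] in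
/-- **`N𝔮 ≡ 1 (mod N)` for `𝔮 ∈ frobeniusClassPrimes ρ S τ N`, `τ ∈ Gal(K̄/K(μ_N))`**: the
Frobenius `σ` of the definition fixes `μ_N` (as `σ τ⁻¹` and `τ` do), so `χ_N(σ) = 1`, while
`χ_N(Frob_𝔓) = N𝔮` (tree `modNCyclotomicCharacter_eq_residueCard_of_isArithFrobAt`, `𝔓 ∤ N`).
Sakamoto, JTNB 36 (2024) §2 (`𝔮` unramified in `H_α ⊇ K(μ_{3^α})`, `Fr_𝔮 ~ τ ∈ G_{K(μ_{3^α})}`);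
Rubin, PCMI 18 Def. 2.1.3 ("`ℓ ≡ 1 (mod p^m)`"). [folklore] -/
theorem natCast_absNorm_eq_one (S : Set (HeightOneSpectrum (𝓞 K))) {τ : absoluteGaloisGroup K}
    (hτ : τ ∈ rootsOfUnityFixer K N) {q : HeightOneSpectrum (𝓞 K)}
    (hq : q ∈ frobeniusClassPrimes ρ S τ N) :
    ((Ideal.absNorm q.asIdeal : ℕ) : ZMod N) = 1 := by
  obtain ⟨-, hNq, -, σ, ⟨𝔓, h𝔓, hσ⟩, -, hζ⟩ := hq
  haveI := h𝔓.1
  have hσμ : ∀ t : AlgebraicClosure K, t ^ N = 1 → σ • t = t := fun t ht => by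
    have h1 := hζ t ht
    have h2 : τ⁻¹ • t = t := (rootsOfUnityFixer K N).inv_mem hτ t ht
    rwa [mul_smul, h2] at h1
  have hN𝔓 : ((N : ℕ) : absIntegers (𝓞 K) K) ∉ 𝔓 := by
    intro h
    apply hNq
    rw [h𝔓.2.over, Ideal.under_def, Ideal.mem_comap, map_natCast]
    exact h
  obtain ⟨ζ, hζN⟩ := HasEnoughRootsOfUnity.exists_primitiveRoot (AlgebraicClosure K) N
  have hχ1 := modNCyclotomicCharacter_eq_of_smul_eq_pow K N hζN σ (c := 1)
    (by rw [pow_one]; exact hσμ ζ hζN.pow_eq_one)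
  have hχq := modNCyclotomicCharacter_eq_residueCard_of_isArithFrobAt (K := K) (N := N) h𝔓 hN𝔓 hσ
  rw [hχ1, Nat.cast_one] at hχq
  exact hχq.symm

end SakamotoPrimes

/-! ### §11 `K = ℚ`: the Kolyvagin datum with THE canonical comparison maps at Sakamoto's primes -/

section Rat

open NumberField IsDedekindDomain
open Literature.NumberTheory.GaloisCohomology
open scoped NumberField

variable {M : Type} [AddCommGroup M] [TopologicalSpace M] [DiscreteTopology M]
variable (ρ : DiscreteGaloisModule ℚ M) (N : ℕ) [NeZero N] [Module (ZMod N) M]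
  [Module.Free (ZMod N) M] [Module.Finite (ZMod N) M]

/-- `N𝔮` is a prime number for a finite place `𝔮 = (ℓ)` of `ℚ` (`N𝔮 = ℓ = natGenerator 𝔮`, cf. the
tree's `Rat.residueCard_eq_natGenerator` / `UniformABCConjecture.absNorm_asIdeal_eq_natGenerator`,
whose one-line computation is repeated inside the proof to keep this file's imports inside the
topic). [folklore] -/
theorem prime_absNorm_rat (q : HeightOneSpectrum (𝓞 ℚ)) : (Ideal.absNorm q.asIdeal).Prime := by
  have h : Ideal.span {(Rat.HeightOneSpectrum.natGenerator q : ℤ)} =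
      q.asIdeal.map (Rat.IsIntegralClosure.intEquiv (𝓞 ℚ) : 𝓞 ℚ →+* ℤ) :=
    Rat.HeightOneSpectrum.span_natGenerator q
  have hN : Ideal.absNorm q.asIdeal = Rat.HeightOneSpectrum.natGenerator q := by
    change q.residueCard = _
    rw [q.residueCard_eq_card_quotient, Nat.card_congr ((Ideal.quotientEquiv _ _
      (Rat.IsIntegralClosure.intEquiv (𝓞 ℚ)) h).trans (Int.quotientSpanNatEquivZMod _)).toEquiv,
      Nat.card_zmod]
  rw [hN]
  exact Rat.HeightOneSpectrum.prime_natGenerator q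

omit [Module (ZMod N) M] [Module.Free (ZMod N) M] [Module.Finite (ZMod N) M] in
/-- Over `ℚ`: `N𝔮 = ℓ` is prime, so a generator `η` of `(ℤ/ℓ)ˣ` has order `ℓ − 1`, and
`ℓ ≡ 1 (mod N)` (`natCast_absNorm_eq_one`) gives **`N ∣ ord η`** at every
`𝔮 ∈ frobeniusClassPrimes ρ S τ N`. [folklore] -/
theorem dvd_orderOf_of_mem_frobeniusClassPrimes (S : Set (HeightOneSpectrum (𝓞 ℚ)))
    {τ : absoluteGaloisGroup ℚ} (hτ : τ ∈ rootsOfUnityFixer ℚ N) {q : HeightOneSpectrum (𝓞 ℚ)}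
    (hq : q ∈ frobeniusClassPrimes ρ S τ N) (η : (ZMod (Ideal.absNorm q.asIdeal))ˣ)
    (hη : Subgroup.zpowers η = ⊤) : N ∣ orderOf η := by
  classical
  have hprime : (Ideal.absNorm q.asIdeal).Prime := prime_absNorm_rat q
  haveI : Fact (Ideal.absNorm q.asIdeal).Prime := ⟨hprime⟩
  have hord : orderOf η = Ideal.absNorm q.asIdeal - 1 := by
    rw [orderOf_eq_card_of_forall_mem_zpowers (fun x => by rw [hη]; exact Subgroup.mem_top x),
      Nat.card_eq_fintype_card, ZMod.card_units_eq_totient, Nat.totient_prime hprime]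
  have h1 := natCast_absNorm_eq_one ρ N S hτ hq
  have h2 : (((Ideal.absNorm q.asIdeal - 1 : ℕ) : ℕ) : ZMod N) = 0 := by
    rw [Nat.cast_sub hprime.one_le, h1, Nat.cast_one, sub_self]
  rw [hord]
  exact (ZMod.natCast_eq_zero_iff _ _).mp h2

/-- **Over `ℚ`, the Kolyvagin datum with Sakamoto's primes, given transverse conditions and THE
canonical finite–singular comparison maps EXISTS** — the binders `(D) (hP) (hT) (hD)` of
`GaloisImage.kolyvaginSystems_freeRankOne_propagatedSelmerStructure` (n1011-p13, p255331) /
`…_weil` (n1011-p18, p257091) replaced by the primitive roots `η` alone: for a discrete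
`Γ_ℚ`-module `T` free of finite rank over `ℤ/N`, `τ ∈ Gal(ℚ̄/ℚ(μ_N))` with `T/(τ − 1)T ≅ ℤ/N`
(Sakamoto's (H.2)), any `S`, any `𝒯`, and primitive roots `η_ℓ` mod `ℓ` at the primes of
`𝒫 = frobeniusClassPrimes ρ S τ N`, there is `D` with `D.primes = 𝒫`, `D.transverse = 𝒯`,
`D.HasCanonicalComparison N η`. (At `ℓ ∈ 𝒫`: `T` unramified by definition of `𝒫`;
`N ∣ ℓ − 1 = ord η_ℓ` by `dvd_orderOf_of_mem_frobeniusClassPrimes`; `P(1) = 0` by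
`eval_one_comparisonP_toLocal_eq_zero`; then `exists_kolyvaginDatum_hasCanonicalComparison`.)
Rubin, PCMI 18 (2011) Def. 1.9.6, Def. 2.1.3; Kim, AJM 148 §2.2.2; Sakamoto, JTNB 36 (2024) §2, §4.
[folklore] -/
theorem exists_kolyvaginDatum_hasCanonicalComparison_frobeniusClassPrimes
    (S : Set (HeightOneSpectrum (𝓞 ℚ))) {τ : absoluteGaloisGroup ℚ}
    (hτ : τ ∈ rootsOfUnityFixer ℚ N) (hcoker : Nonempty (cokerSubOne ρ τ ≃+ ZMod N))
    (T : SelmerStructure ρ) (η : (q : HeightOneSpectrum (𝓞 ℚ)) → (ZMod (Ideal.absNorm q.asIdeal))ˣ)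
    (hη : ∀ q ∈ frobeniusClassPrimes ρ S τ N, Subgroup.zpowers (η q) = ⊤) :
    ∃ D : KolyvaginDatum ρ, D.primes = frobeniusClassPrimes ρ S τ N ∧ D.transverse = T ∧
      D.HasCanonicalComparison N η :=
  exists_kolyvaginDatum_hasCanonicalComparison ρ N _ T η hη
    (fun q hq => dvd_orderOf_of_mem_frobeniusClassPrimes ρ N S hτ hq (η q) (hη q hq))
    (fun _ hq => hq.2.2.1) (fun _ hq φ hφ => eval_one_comparisonP_toLocal_eq_zero ρ N S τ hcoker hq φ hφ)

/-- **Primitive roots included**: over `ℚ` the choice `η` exists as well (`(ℤ/ℓ)ˣ` is cyclic), so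
for Sakamoto's primes there are `η` AND `D` with `D.HasCanonicalComparison N η` outright — Kim's
"choice of the primitive roots in the definition of Kurihara numbers" (§2.2.2) made once and for
all by `Classical.choice`. [folklore] -/
theorem exists_eta_kolyvaginDatum_hasCanonicalComparison_frobeniusClassPrimes
    (S : Set (HeightOneSpectrum (𝓞 ℚ))) {τ : absoluteGaloisGroup ℚ}
    (hτ : τ ∈ rootsOfUnityFixer ℚ N) (hcoker : Nonempty (cokerSubOne ρ τ ≃+ ZMod N))
    (T : SelmerStructure ρ) :
    ∃ (η : (q : HeightOneSpectrum (𝓞 ℚ)) → (ZMod (Ideal.absNorm q.asIdeal))ˣ) (D : KolyvaginDatum ρ),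
      D.primes = frobeniusClassPrimes ρ S τ N ∧ D.transverse = T ∧ D.HasCanonicalComparison N η := by
  have hgen : ∀ q : HeightOneSpectrum (𝓞 ℚ), ∃ η : (ZMod (Ideal.absNorm q.asIdeal))ˣ,
      Subgroup.zpowers η = ⊤ := fun q => by
    haveI : Fact (Ideal.absNorm q.asIdeal).Prime := ⟨prime_absNorm_rat q⟩
    obtain ⟨g, hg⟩ := IsCyclic.exists_generator (α := (ZMod (Ideal.absNorm q.asIdeal))ˣ)
    exact ⟨g, (Subgroup.eq_top_iff' _).mpr hg⟩
  choose η hη using hgen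
  exact ⟨η, exists_kolyvaginDatum_hasCanonicalComparison_frobeniusClassPrimes ρ N S hτ hcoker T η
    fun q _ => hη q⟩

end Rat

end FSComp

end Summit.BirchSwinnertonDyer.Rank1Residual.GaloisImage

end
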